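import Mathlib
import Summits.NavierStokesRegularity.FluidComputer.AbcLatticePairingDomain
import Summits.NavierStokesRegularity.FluidComputer.AbcLinearisedPairing
import HarnessLib

/-!
# Tail coercivity of `x − L_R` for the ABC lattice operator: the certificates' TAIL CONSTANT step
# `x + |k|²/R − √2` as an operator inequality (ASSEMBLY obligation (A4), tail half, of
# `HOME/instab4/KERNEL-CHAIN.md`; instab4 g5 — implementation 2 of the X0 chain, cell `ns-blowup`,
# 2026-08-26)

HONEST FRAMING (human ruling D-0035): nothing here is a claim about Navier–Stokes blow-up.
WHAT THIS IS NOT: not NS evidence; MODEL lane (linearisation of forced Navier–Stokes about the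
exact steady ABC state `U = Torus.abcFlow 1 1 1`, force `f = νU`, in the certifiers' units on
`(ℝ/2πℤ)³`: `L_R c(k) = −(1/R)|k|² c(k) + Π_k X c(k)`, `X c(k) = Σ_{s∈{±e_j}} Û(s) × (i(k−s) × c(k−s) − c(k−s))`,
cert.py/galerkin.py; `AbcLatticeEigenSynthesis.isLinNSEigenvalue_abcFlow_of_certifier_eigen` identifies it
with the tree's operator). No certificate is moved by this file. Both X0 certifiers (instab3 `i3cert`,
instab4 `cert.py`; SKEWCUT-CERT §3) discharge the modes OUTSIDE the cube `K + 1` by ONE scalar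
inequality, the TAIL CONSTANT `x + (K+2)²/R − √2 > 0` (transcribed as `tail_gt_sqrt_two_*` in
`SkewCutBracketTranscript`), whose justification is the operator inequality

  `Re Σ_k ⟪c(k), ((x − L_R) c)(k)⟫ ≥ (x + m/R − √2) · Σ_k ‖c(k)‖²`  for `c` supported where `|k|² ≥ m`,

i.e. DIAGONAL `Re⟪c(k), (x + |k|²/R) c(k)⟫ = (x + |k|²/R)‖c(k)‖² ≥ (x + m/R)‖c(k)‖²`, PROJECTOR invisible
on transversal mean-free `c` (`⟪c(k), Π_k v⟫ = ⟪c(k), v⟫`, instab3's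
`AbcLinearisedPairing.inner_lerayCoeff_of_transversal`), and the PAIRING bound `s = √2`
(`AbcLatticePairingBound` / `AbcLatticePairingDomain`). Here:

* §1 `sq_le_freqNormSq` (`k_j² ≤ |k|²`: outside the sup-cube `K+1` one has `|k|² ≥ (K+2)²`),
  `re_inner_real_smul_self`, `inner_lerayCoeff_eq` (projector invisible, incl. `k = 0` by `c(0) = 0`).
* §2 `tail_coercive_sum` — the inequality above for finitely supported transversal mean-free `c`
  (every Galerkin section; any real `x`, any `R > 0`, any real `m` with `m ≤ |k|²` on the support).
* §3 `tail_coercive_tsum` — the same on the graph domain (`Σ_k (1+|k|²)‖c(k)‖² < ∞`), with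
  summability of the pairing `k ↦ ⟪c(k), ((x − L_R)c)(k)⟫`.

Mathlib + the files named; no new definitions, no named facts.
-/

noncomputable section

open scoped BigOperators ComplexConjugate Matrix Topology InnerProductSpace
open Filter Set Function MeasureTheory UnitAddTorus

namespace Summit.NavierStokesRegularity.FluidComputer.AbcLatticeTailCoercivity

open Literature.Analysis.FunctionSpaces Literature.Analysis.FunctionSpaces.Torus
open Literature.Analysis.FunctionSpaces.EuclideanSpace
open Literature.Analysis.FluidPDE Literature.Analysis.FluidPDE.ScalarFourier
open Literature.Analysis.FluidPDE.SteadyLattice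
open AbcLatticeEigenSynthesis AbcLatticePairingSplit AbcLatticePairingBound AbcLatticePairingDomain

/-! ## §1 Diagonal part and projector in the pairing -/

/-- `k_j² ≤ |k|²`; hence a mode outside the sup-norm cube `K + 1` has `|k|² ≥ (K+2)²`. [folklore] -/
theorem sq_le_freqNormSq (k : Fin 3 → ℤ) (j : Fin 3) : ((k j : ℤ) : ℝ) ^ 2 ≤ freqNormSq k := by
  rw [freqNormSq]
  exact Finset.single_le_sum (f := fun i => ((k i : ℤ) : ℝ) ^ 2) (fun i _ => sq_nonneg _)
    (Finset.mem_univ j)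

/-- `Re ⟪v, r v⟫ = r ‖v‖²` for real `r`. [folklore] -/
theorem re_inner_real_smul_self (r : ℝ) (v : EuclideanSpace ℂ (Fin 3)) :
    (⟪v, (r : ℂ) • v⟫_ℂ).re = r * ‖v‖ ^ 2 := by
  rw [inner_smul_right, inner_self_eq_norm_sq_to_K, Complex.re_ofReal_mul]
  norm_cast

/-- **The Leray multiplier is invisible in the pairing with a transversal mean-free family**:
`⟪c(k), Π_k v⟫ = ⟪c(k), v⟫` (`k ≠ 0`: `AbcLinearisedPairing.inner_lerayCoeff_of_transversal`;
`k = 0`: `Π_0 = 0` and `c(0) = 0`). -/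
theorem inner_lerayCoeff_eq (c : (Fin 3 → ℤ) → EuclideanSpace ℂ (Fin 3)) (hc0 : c 0 = 0)
    (hdiv : ∀ k : Fin 3 → ℤ, (∑ jj : Fin 3, ((k jj : ℤ) : ℂ) * (c k) jj) = 0) (k : Fin 3 → ℤ)
    (v : EuclideanSpace ℂ (Fin 3)) :
    ⟪c k, Torus.lerayCoeff k v⟫_ℂ = ⟪c k, v⟫_ℂ := by
  by_cases hk : k = 0
  · subst hk
    rw [hc0, inner_zero_left, inner_zero_left]
  · exact AbcLinearisedPairing.inner_lerayCoeff_of_transversal hk (hdiv k) v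

/-! ## §2 Tail coercivity on Galerkin sections -/

/-- **TAIL COERCIVITY of `x − L_R` (finitely supported families).** For `R > 0`, real `x`, and a
finitely supported transversal mean-free Cartesian family `c` (support in `F`) with `|k|² ≥ m` on `F`:
`(x + m/R − √2) · Σ_{k∈F} ‖c(k)‖² ≤ Re Σ_{k∈F} ⟪c(k), (x + |k|²/R) c(k) − Π_k X c(k)⟫`
— the certificates' tail constant as an operator inequality (with `m = (K+2)²` outside the cube
`K+1` via `sq_le_freqNormSq`). MODEL statement; not NS. -/
theorem tail_coercive_sum {R : ℝ} (hR : 0 < R) (x m : ℝ) (c : (Fin 3 → ℤ) → EuclideanSpace ℂ (Fin 3))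
    (F : Finset (Fin 3 → ℤ)) (hcF : ∀ k ∉ F, c k = 0) (hc0 : c 0 = 0)
    (hdiv : ∀ k : Fin 3 → ℤ, (∑ jj : Fin 3, ((k jj : ℤ) : ℂ) * (c k) jj) = 0)
    (hm : ∀ k ∈ F, m ≤ freqNormSq k) :
    (x + m / R - Real.sqrt 2) * ∑ k ∈ F, ‖c k‖ ^ 2 ≤
      (∑ k ∈ F, ⟪c k, ((x + freqNormSq k / R : ℝ) : ℂ) • c k -
        Torus.lerayCoeff k (∑ s ∈ Torus.abcFreq,
          (WithLp.toLp 2 (crossProduct (WithLp.ofLp (Torus.abcCoeff 1 1 1 s))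
            (Complex.I • crossProduct (fun j => (((k - s) j : ℤ) : ℂ)) (WithLp.ofLp (c (k - s))) -
              WithLp.ofLp (c (k - s)))) : EuclideanSpace ℂ (Fin 3)))⟫_ℂ).re := by
  have hpair := abs_re_sum_inner_crossForm_le c F hcF hdiv
  simp_rw [inner_sub_right, inner_lerayCoeff_eq c hc0 hdiv]
  rw [Finset.sum_sub_distrib, Complex.sub_re, Complex.re_sum]
  simp_rw [re_inner_real_smul_self]
  -- diagonal part
  have hdiag : (x + m / R) * ∑ k ∈ F, ‖c k‖ ^ 2 ≤ ∑ k ∈ F, (x + freqNormSq k / R) * ‖c k‖ ^ 2 := by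
    rw [Finset.mul_sum]
    refine Finset.sum_le_sum fun k hk => mul_le_mul_of_nonneg_right ?_ (sq_nonneg _)
    have h1 : m / R ≤ freqNormSq k / R := div_le_div_of_nonneg_right (hm k hk) hR.le
    linarith
  -- pairing part
  have hp := le_abs_self ((∑ k ∈ F, ⟪c k, ∑ s ∈ Torus.abcFreq,
      (WithLp.toLp 2 (crossProduct (WithLp.ofLp (Torus.abcCoeff 1 1 1 s))
        (Complex.I • crossProduct (fun j => (((k - s) j : ℤ) : ℂ)) (WithLp.ofLp (c (k - s))) -
          WithLp.ofLp (c (k - s)))) : EuclideanSpace ℂ (Fin 3))⟫_ℂ).re)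
  nlinarith [hpair, hdiag, hp, Finset.sum_nonneg (fun k (_ : k ∈ F) => sq_nonneg ‖c k‖)]

/-! ## §3 Tail coercivity on the graph domain -/

/-- **TAIL COERCIVITY of `x − L_R` on the graph domain.** For `R > 0`, real `x`, and a transversal
mean-free Cartesian family `c` with `Σ_k (1+|k|²)‖c(k)‖² < ∞` vanishing where `|k|² < m`: the pairing
`k ↦ ⟪c(k), (x + |k|²/R) c(k) − Π_k X c(k)⟫` is summable and
`(x + m/R − √2) · Σ_k ‖c(k)‖² ≤ Re Σ_k ⟪c(k), (x + |k|²/R) c(k) − Π_k X c(k)⟫`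
(`tail_coercive_sum` + the density step `AbcLatticePairingDomain.abs_re_tsum_inner_crossForm_le`).
MODEL statement; not NS. -/
theorem tail_coercive_tsum {R : ℝ} (hR : 0 < R) (x m : ℝ) (c : (Fin 3 → ℤ) → EuclideanSpace ℂ (Fin 3))
    (hc0 : c 0 = 0) (hdiv : ∀ k : Fin 3 → ℤ, (∑ jj : Fin 3, ((k jj : ℤ) : ℂ) * (c k) jj) = 0)
    (hc : Summable fun k : Fin 3 → ℤ => (1 + freqNormSq k) * ‖c k‖ ^ 2)
    (hm : ∀ k : Fin 3 → ℤ, c k ≠ 0 → m ≤ freqNormSq k) :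
    Summable (fun k : Fin 3 → ℤ => ⟪c k, ((x + freqNormSq k / R : ℝ) : ℂ) • c k -
        Torus.lerayCoeff k (∑ s ∈ Torus.abcFreq,
          (WithLp.toLp 2 (crossProduct (WithLp.ofLp (Torus.abcCoeff 1 1 1 s))
            (Complex.I • crossProduct (fun j => (((k - s) j : ℤ) : ℂ)) (WithLp.ofLp (c (k - s))) -
              WithLp.ofLp (c (k - s)))) : EuclideanSpace ℂ (Fin 3)))⟫_ℂ) ∧
    (x + m / R - Real.sqrt 2) * ∑' k : Fin 3 → ℤ, ‖c k‖ ^ 2 ≤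
      (∑' k : Fin 3 → ℤ, ⟪c k, ((x + freqNormSq k / R : ℝ) : ℂ) • c k -
        Torus.lerayCoeff k (∑ s ∈ Torus.abcFreq,
          (WithLp.toLp 2 (crossProduct (WithLp.ofLp (Torus.abcCoeff 1 1 1 s))
            (Complex.I • crossProduct (fun j => (((k - s) j : ℤ) : ℂ)) (WithLp.ofLp (c (k - s))) -
              WithLp.ofLp (c (k - s)))) : EuclideanSpace ℂ (Fin 3)))⟫_ℂ).re := by
  obtain ⟨hXsum, hXle⟩ := abs_re_tsum_inner_crossForm_le c hdiv hc
  -- ℓ² bookkeeping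
  have hc0' : Summable fun k : Fin 3 → ℤ => ‖c k‖ ^ 2 := by
    refine Summable.of_nonneg_of_le (fun k => by positivity) (fun k => ?_) hc
    have := one_le_one_add_freqNormSq k
    nlinarith [sq_nonneg ‖c k‖]
  have hdsum : Summable fun k : Fin 3 → ℤ => (x + freqNormSq k / R) * ‖c k‖ ^ 2 := by
    refine Summable.of_norm_bounded ((hc.mul_left (|x| + 1 / R))) fun k => ?_
    rw [Real.norm_eq_abs, abs_mul, abs_of_nonneg (sq_nonneg ‖c k‖), ← mul_assoc]
    refine mul_le_mul_of_nonneg_right ?_ (sq_nonneg _)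
    have hf := freqNormSq_nonneg k
    have hR' : 0 ≤ 1 / R := by positivity
    calc |x + freqNormSq k / R| ≤ |x| + |freqNormSq k / R| := abs_add_le _ _
      _ = |x| + freqNormSq k / R := by rw [abs_of_nonneg (div_nonneg hf hR.le)]
      _ ≤ (|x| + 1 / R) * (1 + freqNormSq k) := by
          rw [div_eq_mul_one_div]
          nlinarith [abs_nonneg x]
  -- the diagonal pairing is the real family `(x + |k|²/R)‖c(k)‖²`
  have hdiag : ∀ k : Fin 3 → ℤ, ⟪c k, ((x + freqNormSq k / R : ℝ) : ℂ) • c k⟫_ℂ =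
      (((x + freqNormSq k / R) * ‖c k‖ ^ 2 : ℝ) : ℂ) := by
    intro k
    apply Complex.ext
    · rw [re_inner_real_smul_self, Complex.ofReal_re]
    · rw [Complex.ofReal_im, inner_smul_right, Complex.im_ofReal_mul]
      have h0 := inner_self_im (𝕜 := ℂ) (c k)
      simp only [RCLike.im_to_complex] at h0
      rw [h0, mul_zero]
  have hdsumC : Summable fun k : Fin 3 → ℤ => ⟪c k, ((x + freqNormSq k / R : ℝ) : ℂ) • c k⟫_ℂ := by
    simp_rw [hdiag]
    exact (Complex.ofRealCLM.summable hdsum)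
  -- the projected pairing is the unprojected one
  have hproj : ∀ k : Fin 3 → ℤ, ⟪c k, Torus.lerayCoeff k (∑ s ∈ Torus.abcFreq,
      (WithLp.toLp 2 (crossProduct (WithLp.ofLp (Torus.abcCoeff 1 1 1 s))
        (Complex.I • crossProduct (fun j => (((k - s) j : ℤ) : ℂ)) (WithLp.ofLp (c (k - s))) -
          WithLp.ofLp (c (k - s)))) : EuclideanSpace ℂ (Fin 3)))⟫_ℂ =
      ⟪c k, ∑ s ∈ Torus.abcFreq,
      (WithLp.toLp 2 (crossProduct (WithLp.ofLp (Torus.abcCoeff 1 1 1 s))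
        (Complex.I • crossProduct (fun j => (((k - s) j : ℤ) : ℂ)) (WithLp.ofLp (c (k - s))) -
          WithLp.ofLp (c (k - s)))) : EuclideanSpace ℂ (Fin 3))⟫_ℂ :=
    fun k => inner_lerayCoeff_eq c hc0 hdiv k _
  simp_rw [inner_sub_right, hproj]
  refine ⟨hdsumC.sub hXsum, ?_⟩
  rw [hdsumC.tsum_sub hXsum, Complex.sub_re]
  simp_rw [hdiag]
  rw [← Complex.ofReal_tsum, Complex.ofReal_re]
  -- diagonal part
  have hdiag_le : (x + m / R) * ∑' k : Fin 3 → ℤ, ‖c k‖ ^ 2 ≤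
      ∑' k : Fin 3 → ℤ, (x + freqNormSq k / R) * ‖c k‖ ^ 2 := by
    rw [← tsum_mul_left]
    refine Summable.tsum_le_tsum (fun k => ?_) (hc0'.mul_left _) hdsum
    by_cases hk : c k = 0
    · rw [hk, norm_zero]; simp
    · refine mul_le_mul_of_nonneg_right ?_ (sq_nonneg _)
      have h1 : m / R ≤ freqNormSq k / R := div_le_div_of_nonneg_right (hm k hk) hR.le
      linarith
  have hp := le_abs_self ((∑' k : Fin 3 → ℤ, ⟪c k, ∑ s ∈ Torus.abcFreq,
      (WithLp.toLp 2 (crossProduct (WithLp.ofLp (Torus.abcCoeff 1 1 1 s))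
        (Complex.I • crossProduct (fun j => (((k - s) j : ℤ) : ℂ)) (WithLp.ofLp (c (k - s))) -
          WithLp.ofLp (c (k - s)))) : EuclideanSpace ℂ (Fin 3))⟫_ℂ).re)
  have hnn : 0 ≤ ∑' k : Fin 3 → ℤ, ‖c k‖ ^ 2 := tsum_nonneg fun k => sq_nonneg _
  nlinarith [hXle, hdiag_le, hp, hnn]

end Summit.NavierStokesRegularity.FluidComputer.AbcLatticeTailCoercivity

end
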